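import Literature.IUT.HodgeArakelov.CoreTowerNonVacuity
import HarnessLib

/-!
# [IUTchII] Rmk. 1.1.1 (i): NON-VACUITY of `CoreTower` — second GENUINE tower, reading the undecorated display as
# `Π_Y ⊆ Π_X ⊆ Π_C ⊇ Π_X̲ ⊇ Π_X̲̲` (the `𝔽_l^{⋊±}`-compatible reading of [IUTchI] Def. 6.1 (v))

Mochizuki, *Inter-universal Teichmüller theory II*, §1, Remark 1.1.1 (i), kurims manuscript (Dec. 2020) pp. 21–22
[claim: Mochizuki2012, status: disputed] (IUTchII §1 Rmk 1.1.1 (i), kurims pp.21-22). abc-iut cell, layer L6, NV-L6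
row **CoreTower**, seat abc-iut-w5-d225 (gen 5); sequel of `CoreTowerNonVacuity.lean` (p432880).

TEXT-EXTRACTION CAVEAT made explicit. The kurims text layer of the display of Rmk. 1.1.1 (i) reads
«Π_Y(M) ⊆ Π_X(M) ⊆ Π_C(M) (⊇ Π_X(M) ⊇ Π_X(M))» with ALL underline decorations lost (HOME lit render p. 21 l. 49);
abc-iut-L6-t1's interface `CoreTower` restored them as `Π_Y ⊆ Π_X̲ ⊆ Π_C ⊇ Π_X ⊇ Π_X̲̲` (fields `Y ≤ Xbar`,
`Xbarbar ≤ X`, with `Δ_X(M) := X ⊓ Δ_C` entering `FlSymmetry`'s clause "`Δ_C(M)/Δ_X(M) ≅ 𝔽_l^{⋊±}`"), and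
`CoreTowerNonVacuity.lean` inhabited it with `Xbar := inclX(toZ⁻¹(l·ℤ))`, `X := inclX(Π^tp_X)`. Under that
assignment `[Δ_C : X ⊓ Δ_C] = 2` (`C = X/±1`), so the `𝔽_l^{⋊±}`-clause of Rmk. 1.1.1 (iv) ([IUTchI] Def. 6.1 (v):
"`Δ_C/Δ_X̲ ≅ 𝔽_l^{⋊±}`", a group of order `2l`) cannot hold there for `l > 1`. The reading consistent with
[IUTchI] Def. 6.1 (v) and with the two covering chains of [EtTh] §2 (`Y → X → C` on the left, `X̲̲ → X̲ → C` on the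
right) assigns the field `X` to `Π_X̲ = toZ⁻¹(l·ℤ)` (the degree-`l` subcovering of `Y → X`; it contains `Π^tp_{X̲̲}` by
[EtTh] Def. 2.5 (i) "`Π_X̲̲ ↠ l·Z`", `DoubleUnderline.map_toZ_Huu`) and `Xbar` to `Π^tp_X`. THIS FILE inhabits
`CoreTower (F.reconstruction e)` with THAT assignment (all other data — `Π_C = Π^tp_C`, `Π_Y = inclX(Π^tp_{X̲̲} ∩ Π^tp_Y)`,
`Π_X̲̲ = inclX(Π^tp_{X̲̲})`, `isoXbarbar`, `Π_C ↠ G(M)`, `Ker(Π_Y ↠ Π^ell_Y)` and `Δ^ell_Y ≅ Ẑ` — IDENTICAL to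
`exists_coreTower_of_cLevelData`), so that both readings are on record and abc-iut-w5-d219's
`ModelFrame.flSymmetry_nonempty_of_coreTower` can be aimed at a tower whose `𝔽_l^{⋊±}`-clause is not excluded by
index. The two `FlSymmetry` clauses themselves (`Δ_X̲ ∩ Δ_C ⊴ Δ_C` inside `Π^tp_C`, quotient `≅ 𝔽_l ⋊ {±1}`) need
the action of an inversion `ι ∈ Π^tp_C ∖ Π^tp_X` on `Z` (abc-iut-L2-t10 / w5-d072's C-level inversion clauses) and
are NOT proved here. PROOF-ONLY. HONEST FRAMING: a kernel fact about the cell's own typed interfaces under the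
hypotheses `cl`, `IsEtThOrigin`, `hYcl`; which reading print intends is a LIT question (decorations), not settled
here; nothing of [IUTchII] asserted; no side taken on [IUTchIII] Cor. 3.12 (node outside the cone); typed ≠
discharged. [cite: MochizukiEtTh2009, Def 2.5 (i) p.39] [cite: Mochizuki2012, IUTchI Def. 6.1 (v)]
-/

noncomputable section

namespace Literature.IUT.HodgeArakelov

open Literature.AnabelianGeometry.EtaleTheta Literature.AnabelianGeometry.SemiGraphs
open scoped Literature.AnabelianGeometry.EtaleTheta

namespace ModelFrame

variable {p : ℕ} [Fact p.Prime] {Mt : MuTwoSetting p}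
  {E : Mt.toThetaSetting.EtaleThetaData} {l : ℕ} (C : E.DoubleUnderline l)
  {S : ThetaSetting.{0}} (μ : Mt.toThetaSetting.CyclotomeMod l S.N)
  (hC : Mt.toThetaSetting.Compat) (hS : Mt.toThetaSetting.Sec2Hyps)
  (h15 : ThetaSetting.Prop15iii E hC) (L : C.CuspLabels)
  (F : ModelFrame S (C.rigidData μ hC hS h15 L)) {Menv : MonoThetaEnv S}
  (e : Menv.Pi ≃ₜ* (C.rigidData μ hC hS h15 L).env)

/-- **IUTchII:Rmk1.1.1(i) — `CoreTower` at the [EtTh] model, reading `Π_Y ⊆ Π_X ⊆ Π_C ⊇ Π_X̲ ⊇ Π_X̲̲`** (GENUINE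
witness; fields `Xbar := inclX(Π^tp_X)`, `X := inclX(toZ⁻¹(l·ℤ)) = Π_X̲` — both PINNED in the statement (as `HEq`,
the carrier being `W.PiC = Π^tp_C`) — everything else as in `exists_coreTower_of_cLevelData`, with the same formula
for `W.kerEll`).
[claim: Mochizuki2012, status: disputed] (IUTchII §1 Rmk 1.1.1 (i), kurims pp.21-22) -/
theorem exists_coreTower_of_cLevelData' (cl : Mt.CLevelData) (hO : Mt.toThetaSetting.IsEtThOrigin)
    (hYcl : (Mt.DtpY.map Mt.toHat.toMonoidHom).topologicalClosure ≤
      Mt.DtpY.map Mt.toHat.toMonoidHom ⊔ (⁅⁅Mt.DeltaHat, Mt.DeltaHat⁆, Mt.DeltaHat⁆).topologicalClosure) :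
    ∃ W : CoreTower (F.reconstruction e), W.PiC = TopGroup.of Mt.GtpC ∧
      W.kerEll = ((Mt.thetaToEll.comp Mt.toTheta).ker).comap
        (C.Huu.subtype.comp (Mt.GtpY.subgroupOf C.Huu).subtype) ∧
      HEq W.Xbar Mt.inclX.range ∧
      HEq W.X (((Subgroup.zpowers (Multiplicative.ofAdd (l : ℤ))).comap Mt.toZ).map Mt.inclX) := by
  classical
  -- ### notation
  set R : RigidData S.N l := C.rigidData μ hC hS h15 L with hRdef
  have hι : Topology.IsOpenEmbedding Mt.inclX := cl.isOpenEmbedding_inclX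
  -- ### `(Δ^tp_{Y̲̲})^ell ≅ Ẑ` (abc-iut-w5-d024, `Discharge/Sec1DeltaYuuEllZHat`)
  obtain ⟨eδ⟩ := C.nonempty_deltaYuuEll_mulEquiv_zHat hO hYcl
  -- ### the open embedding `Π^tp_{X̲̲} ≃ₜ* inclX(Π^tp_{X̲̲})`
  have hmemrange : ∀ y : ↥(C.Huu.map Mt.inclX), (y : Mt.GtpC) ∈ Mt.inclX.range := fun y =>
    Subgroup.map_le_range _ _ y.2
  have hinv_mem : ∀ y : ↥(C.Huu.map Mt.inclX),
      (MonoidHom.ofInjective Mt.injective_inclX).symm ⟨y, hmemrange y⟩ ∈ C.Huu := by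
    intro y
    obtain ⟨x, hx, hxy⟩ := Subgroup.mem_map.1 y.2
    have : (MonoidHom.ofInjective Mt.injective_inclX).symm ⟨y, hmemrange y⟩ = x :=
      Mt.injective_inclX (by rw [MonoidHom.apply_ofInjective_symm]; exact hxy.symm)
    rw [this]; exact hx
  let iX : ↥C.Huu ≃ₜ* ↥(C.Huu.map Mt.inclX) :=
    { toFun := fun x => ⟨Mt.inclX x, Subgroup.mem_map_of_mem Mt.inclX x.2⟩
      invFun := fun y => ⟨(MonoidHom.ofInjective Mt.injective_inclX).symm ⟨y, hmemrange y⟩, hinv_mem y⟩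
      left_inv := fun x => by
        apply Subtype.ext
        apply Mt.injective_inclX
        simp only [MonoidHom.apply_ofInjective_symm]
      right_inv := fun y => by
        apply Subtype.ext
        simp only [MonoidHom.apply_ofInjective_symm]
      map_mul' := fun x y => Subtype.ext (by simp only [Subgroup.coe_mul, map_mul])
      continuous_toFun := (Mt.continuous_inclX.comp continuous_subtype_val).subtype_mk _
      continuous_invFun := by
        apply Continuous.subtype_mk
        exact cl.continuous_ofInjective_symm.comp (continuous_subtype_val.subtype_mk _) }
  -- ### the surjection `Π^tp_C ↠ G(M) = Π^tp_{X̲̲}/Δ ≅ G_K`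
  have haugC_mem : ∀ g : Mt.GtpC, cl.augC g ∈ Mt.GK := fun g => by
    rw [← cl.range_augC]; exact ⟨g, rfl⟩
  let aC : Mt.GtpC →* ↥Mt.GK := cl.augC.toMonoidHom.codRestrict Mt.GK haugC_mem
  have aC_surj : Function.Surjective aC := by
    intro γ
    have hγ : (γ : GQp p) ∈ cl.augC.range := by rw [cl.range_augC]; exact γ.2
    obtain ⟨g, hg⟩ := hγ
    exact ⟨g, Subtype.ext hg⟩
  let eG : (↥C.Huu ⧸ R.aug.ker) ≃* ↥Mt.GK :=
    QuotientGroup.quotientKerEquivOfSurjective R.aug R.aug_surjective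
  have eG_mk : ∀ x : ↥C.Huu, eG (QuotientGroup.mk x) = R.aug x := fun _ => rfl
  let π : Mt.GtpC →* (↥C.Huu ⧸ R.aug.ker) := eG.symm.toMonoidHom.comp aC
  -- ### `Ker(Π_Y(M) ↠ Π^ell_Y(M))` : `Ker(Π^tp_X ↠ (Π^tp_X)^ell)` pulled back to `Π_Y(M) = Π^tp_{Y̲̲}`
  let K₀ : Subgroup Mt.PiTemp := (Mt.thetaToEll.comp Mt.toTheta).ker
  let kerEll : Subgroup ↥(Mt.GtpY.subgroupOf C.Huu) :=
    K₀.comap (C.Huu.subtype.comp (Mt.GtpY.subgroupOf C.Huu).subtype)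
  haveI hK₀n : K₀.Normal := MonoidHom.normal_ker _
  haveI hkn : kerEll.Normal := Subgroup.Normal.comap hK₀n _
  -- ### transport `Δ_Y(M) ≃* Π^tp_{X̲̲} ∩ Δ^tp_Y` (tautological: both are `{x ∈ Π^tp_{X̲̲} ∩ Π^tp_Y | aug x = 1}`)
  let φ : ↥(F.reconstruction e).DeltaY ≃* ↥(C.Huu ⊓ Mt.DtpY) :=
    { toFun := fun y => ⟨((y.1 : ↥C.Huu) : Mt.PiTemp),
        ⟨(y.1 : ↥C.Huu).2, ⟨Subgroup.mem_subgroupOf.1 y.1.2,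
          (mem_deltaY_reconstruction_iff C μ hC hS h15 L F e y.1).1 y.2⟩⟩⟩
      invFun := fun z => ⟨⟨⟨z.1, z.2.1⟩, Subgroup.mem_subgroupOf.2 z.2.2.1⟩,
        (mem_deltaY_reconstruction_iff C μ hC hS h15 L F e _).2 z.2.2.2⟩
      left_inv := fun _ => rfl
      right_inv := fun _ => rfl
      map_mul' := fun _ _ => rfl }
  have hφ : Subgroup.map (↑φ) (kerEll.subgroupOf (F.reconstruction e).DeltaY) =
      K₀.subgroupOf (C.Huu ⊓ Mt.DtpY) := by
    ext z
    constructor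
    · rintro ⟨y, hy, rfl⟩
      exact hy
    · intro hz
      exact ⟨φ.symm z, hz, φ.apply_symm_apply z⟩
  haveI : (K₀.subgroupOf (C.Huu ⊓ Mt.DtpY)).Normal := inferInstance
  haveI : (kerEll.subgroupOf (F.reconstruction e).DeltaY).Normal := inferInstance
  -- ### assembly
  refine ⟨{ PiC := TopGroup.of Mt.GtpC
            Y := (C.Huu ⊓ Mt.GtpY).map Mt.inclX
            Xbar := Mt.inclX.range
            X := ((Subgroup.zpowers (Multiplicative.ofAdd (l : ℤ))).comap Mt.toZ).map Mt.inclX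
            Xbarbar := C.Huu.map Mt.inclX
            Y_le_Xbar := Subgroup.map_le_range _ _
            Xbarbar_le_X := ?_
            Y_le_Xbarbar := Subgroup.map_mono inf_le_left
            isOpen_Y := ?_
            isOpen_Xbar := Mt.isOpen_range_inclX
            isOpen_X := ?_
            isOpen_Xbarbar := ?_
            isoXbarbar := iX
            isoXbarbar_Y := ?_
            projG := π
            projG_surjective := eG.symm.surjective.comp aC_surj
            projG_compat := ?_
            kerEll := kerEll
            kerEll_normal := hkn
            deltaEll_iso := ⟨(QuotientGroup.congr _ _ φ hφ).trans eδ⟩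
            deltaEll_normal := inferInstance }, rfl, rfl, HEq.rfl, HEq.rfl⟩
  · -- `Π_X̲̲ ⊆ Π_X̲` : `toZ(Π^tp_{X̲̲}) = l·ℤ` ([EtTh] Def. 2.5 (i), `DoubleUnderline.map_toZ_Huu`)
    refine Subgroup.map_mono fun x hx => ?_
    rw [Subgroup.mem_comap, ← C.map_toZ_Huu]
    exact Subgroup.mem_map_of_mem _ hx
  · -- `Π_Y` open
    rw [Subgroup.coe_map]
    exact hι.isOpenMap _ (C.isOpen_Huu.inter Mt.toThetaSetting.isOpen_ker_toZ)
  · -- `Π_X̲` open : it contains the open subgroup `Ker(toZ)`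
    rw [Subgroup.coe_map]
    refine hι.isOpenMap _ (Subgroup.isOpen_mono ?_ Mt.toThetaSetting.isOpen_ker_toZ)
    intro x hx
    have hx1 : Mt.toZ x = 1 := hx
    simp only [Subgroup.mem_comap, hx1, one_mem]
  · -- `Π_X̲̲` open
    rw [Subgroup.coe_map]
    exact hι.isOpenMap _ C.isOpen_Huu
  · -- `isoXbarbar` carries `Π_Y(M) = Π^tp_Y ∩ Π^tp_{X̲̲}` onto `Π_Y = inclX(Π^tp_{X̲̲} ∩ Π^tp_Y)`
    ext g
    constructor
    · intro hg
      obtain ⟨y, hy, hyg⟩ := Subgroup.mem_map.1 hg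
      obtain ⟨y', hy'⟩ := MonoidHom.mem_range.1 hy
      subst hy'
      subst hyg
      exact Subgroup.mem_map.2
        ⟨((y' : ↥C.Huu) : Mt.PiTemp), ⟨(y' : ↥C.Huu).2, Subgroup.mem_subgroupOf.1 y'.2⟩, rfl⟩
    · intro hg
      obtain ⟨x, hx, hxg⟩ := Subgroup.mem_map.1 hg
      subst hxg
      exact Subgroup.mem_map.2 ⟨⟨x, hx.1⟩,
        MonoidHom.mem_range.2 ⟨⟨⟨x, hx.1⟩, Subgroup.mem_subgroupOf.2 hx.2⟩, rfl⟩, rfl⟩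
  · -- compatibility of `Π_C ↠ G(M)` with `Π_X(M) ↠ G(M)` : `augC ∘ inclX = aug`
    intro x
    change eG.symm (aC (Mt.inclX x)) = QuotientGroup.mk x
    rw [MulEquiv.symm_apply_eq, eG_mk]
    apply Subtype.ext
    change cl.augC (Mt.inclX x) = _
    rw [cl.augC_inclX]
    rfl

end ModelFrame

end Literature.IUT.HodgeArakelov

end
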